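import Literature.NumberTheory.LFunctions.MollifiedSecondMoment
import Mathlib.NumberTheory.LSeries.Convolution
import Mathlib.NumberTheory.LSeries.Dirichlet
import Mathlib.NumberTheory.LSeries.Linearity
import HarnessLib

/-!
# Power saving of the plateau mollifier: `ζ(s) ψ_X(s) = 1 + O(X^{-1/2})` for `Re s ≥ 3`

Topic `Literature/NumberTheory/LFunctions`. Everything in this file is PROVED (no definitions, no
named facts).

For `Re s > 1`, `ζ(s) ψ_X(s) = ∑_N c_N N^{-s}` with `c_N = ∑_{d ∣ N, d ≤ X} w_d`. Since the plateau
weights satisfy `w_d = μ(d)` for `d² ≤ X`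
(`Literature.NumberTheory.LFunctions.PlateauMollifier.weight_eq_moebius`), `c_1 = 1` and `c_N = 0` for
`1 < N ≤ X^{1/2}`, while `|c_N| ≤ d(N) ≤ N` always. Hence for `Re s ≥ 3`,
`|ζ(s)ψ_X(s) − 1| ≤ ∑_{N > X^{1/2}} N^{1−3} ≤ 1/⌊X^{1/2}⌋ ≤ 2 X^{-1/2}`: the mollified zeta
function is `1 + O(X^{-1/2})` far to the right, with a POWER saving — this (and not the choice of
Selberg's `δ_r`) is what the convexity argument of Titchmarsh §9.24 / Selberg's density theorem
needs on the right-hand line.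

* `Literature.NumberTheory.LFunctions.TwistedMoment.norm_zeta_mul_plateauMollifier_sub_one_le` —
  for `X ≥ 4` and `Re s ≥ 3`, `‖ζ(s) ψ_X(s) − 1‖ ≤ 2 X^{-1/2}`.

## References

* E. C. Titchmarsh, *The Theory of the Riemann Zeta-Function*, 2nd ed. (1986), §9.24 (and §9.16 for
  the role of `ζψ − 1` on a line far to the right). [cite: Titchmarsh1986, §9.24]
* A. Selberg, *On the zeros of Riemann's zeta-function*, Skr. Norske Vid.-Akad. Oslo I 1942, no. 10.
-/

noncomputable section

open Finset Real Complex LSeries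
open scoped LSeries.notation
open scoped ArithmeticFunction.Moebius ArithmeticFunction.zeta
open Literature.NumberTheory.LFunctions.PlateauMollifier (weight abs_weight_le_one weight_one weight_eq_moebius)

namespace Literature.NumberTheory.LFunctions.TwistedMoment

/-! ### The mollifier as an L-series with finitely supported coefficients -/

/-- `ψ_X(s) = L(w, s)` with `w_d = weight X d · [1 ≤ d ≤ X]`. [folklore] -/
theorem plateauMollifier_eq_LSeries (X : ℝ) (s : ℂ) :
    plateauMollifier X s =
      LSeries (fun d => if d ∈ Finset.Icc 1 ⌊X⌋₊ then ((weight X d : ℝ) : ℂ) else 0) s := by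
  rw [plateauMollifier_def, LSeries]
  rw [tsum_eq_sum (s := Finset.Icc 1 ⌊X⌋₊)]
  · refine Finset.sum_congr rfl fun d hd => ?_
    have hd0 : d ≠ 0 := by have := (Finset.mem_Icc.1 hd).1; omega
    rw [term_of_ne_zero hd0, if_pos hd, cpow_neg, div_eq_mul_inv]
  · intro d hd
    rcases Nat.eq_zero_or_pos d with rfl | hpos
    · exact term_zero _ _
    · rw [term_of_ne_zero hpos.ne', if_neg hd, zero_div]

/-! ### `∑_{d ∣ n} μ(d) = [n = 1]` -/

/-- `∑_{d ∣ n} μ(d) = [n = 1]` in `ℂ`. [folklore] -/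
theorem sum_divisors_moebius_complex (n : ℕ) :
    ∑ d ∈ n.divisors, ((μ d : ℤ) : ℂ) = if n = 1 then 1 else 0 := by
  have h := congrArg (fun f : ArithmeticFunction ℤ => f n) ArithmeticFunction.moebius_mul_coe_zeta
  simp only [ArithmeticFunction.coe_mul_zeta_apply, ArithmeticFunction.one_apply] at h
  exact_mod_cast h

/-! ### The power saving -/

/-- Tails of `∑ N^{-2}`: `∑_{Y < N ≤ K} N^{-2} ≤ 1/Y` for `Y ≥ 1` (telescoping `1/(N−1) − 1/N`). [folklore] -/
theorem sum_Ioc_inv_sq_le {Y K : ℕ} (hY : 1 ≤ Y) :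
    ∑ N ∈ Finset.Ioc Y K, (1 : ℝ) / ((N : ℝ) ^ 2) ≤ 1 / Y := by
  have key : ∀ K, Y ≤ K → ∑ N ∈ Finset.Ioc Y K, (1 : ℝ) / ((N : ℝ) ^ 2) ≤ 1 / Y - 1 / K := by
    intro K hK
    induction K, hK using Nat.le_induction with
    | base => simp
    | succ K hYK ih =>
      rw [Finset.sum_Ioc_succ_top (by omega), Nat.cast_succ]
      have hK0 : (0 : ℝ) < K := by exact_mod_cast (show 0 < K by omega)
      have hstep : 1 / (((K : ℝ) + 1) ^ 2) ≤ 1 / (K : ℝ) - 1 / ((K : ℝ) + 1) := by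
        rw [div_sub_div _ _ hK0.ne' (by linarith), div_le_div_iff₀ (by positivity) (by positivity)]
        nlinarith
      linarith
  rcases le_or_gt Y K with h | h
  · have hK0 : (0 : ℝ) ≤ 1 / K := by positivity
    linarith [key K h]
  · rw [Finset.Ioc_eq_empty (by omega), Finset.sum_empty]; positivity

/-- **`ζ(s) ψ_X(s) = 1 + O(X^{-1/2})` on `Re s ≥ 3`**: for `X ≥ 4` and `Re s ≥ 3`,
`‖ζ(s) ψ_X(s) − 1‖ ≤ 2 X^{-1/2}` (the Dirichlet coefficients of `ζψ_X` are `[N = 1]` for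
`N ≤ X^{1/2}` because `w_d = μ(d)` for `d² ≤ X`, and `≤ d(N) ≤ N` in general).
[cite: Titchmarsh1986, §9.24] -/
theorem norm_zeta_mul_plateauMollifier_sub_one_le {X : ℝ} (hX : 4 ≤ X) {s : ℂ} (hs : 3 ≤ s.re) :
    ‖riemannZeta s * plateauMollifier X s - 1‖ ≤ 2 * X ^ (-(1 / 2 : ℝ)) := by
  have hX1 : 1 < X := by linarith
  have hs1 : 1 < s.re := by linarith
  set w : ℕ → ℂ := fun d => if d ∈ Finset.Icc 1 ⌊X⌋₊ then ((weight X d : ℝ) : ℂ) else 0 with hw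
  have hwb : ∀ n ≠ 0, ‖w n‖ ≤ 1 := by
    intro n _
    simp only [hw]
    split_ifs
    · rw [Complex.norm_real, Real.norm_eq_abs]; exact abs_weight_le_one X n
    · simp
  have hw_sum : LSeriesSummable w s := LSeriesSummable_of_bounded_of_one_lt_re hwb hs1
  have h1_sum : LSeriesSummable 1 s :=
    LSeriesSummable_of_bounded_of_one_lt_re (m := 1) (fun n _ => by simp) hs1
  -- `ζ ψ = L(1 ⍟ w)`
  have hprod : riemannZeta s * plateauMollifier X s = LSeries ((1 : ℕ → ℂ) ⍟ w) s := by
    rw [plateauMollifier_eq_LSeries, ← hw, ← LSeries_one_eq_riemannZeta hs1,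
      LSeries_convolution' h1_sum hw_sum]
  set c : ℕ → ℂ := (1 : ℕ → ℂ) ⍟ w with hc
  -- the coefficients
  have hc_apply : ∀ N ≠ 0, c N = ∑ d ∈ N.divisors, w d := by
    intro N hN
    rw [hc, LSeries.convolution_def]
    simp only
    rw [Nat.sum_divisorsAntidiagonal' (fun a b => (1 : ℕ → ℂ) a * w b)]
    exact Finset.sum_congr rfl fun d _ => by simp
  have hc1 : c 1 = 1 := by
    rw [hc_apply 1 one_ne_zero, Nat.divisors_one, Finset.sum_singleton]
    simp only [hw]
    rw [if_pos (Finset.mem_Icc.2 ⟨le_rfl, Nat.floor_pos.2 hX1.le⟩), weight_one hX1]; simp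
  have hc_small : ∀ N : ℕ, 2 ≤ N → (N : ℝ) ^ 2 ≤ X → c N = 0 := by
    intro N hN2 hNX
    rw [hc_apply N (by omega)]
    have hterm : ∀ d ∈ N.divisors, w d = ((μ d : ℤ) : ℂ) := by
      intro d hd
      have hd1 : 1 ≤ d := Nat.pos_of_mem_divisors hd
      have hdN : d ≤ N := Nat.divisor_le hd
      have hd2 : (d : ℝ) ^ 2 ≤ X := by
        have : (d : ℝ) ≤ N := by exact_mod_cast hdN
        nlinarith
      have hdX : d ≤ ⌊X⌋₊ := by
        refine Nat.le_floor ?_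
        have : (1 : ℝ) ≤ d := by exact_mod_cast hd1
        nlinarith
      simp only [hw]
      rw [if_pos (Finset.mem_Icc.2 ⟨hd1, hdX⟩), weight_eq_moebius hX1 hd1 hd2]
      norm_cast
    rw [Finset.sum_congr rfl hterm, sum_divisors_moebius_complex, if_neg (by omega)]
  have hc_bound : ∀ N ≠ 0, ‖c N‖ ≤ N := by
    intro N hN
    rw [hc_apply N hN]
    refine (norm_sum_le _ _).trans ?_
    calc ∑ d ∈ N.divisors, ‖w d‖ ≤ ∑ d ∈ N.divisors, (1 : ℝ) :=
          Finset.sum_le_sum fun d hd => hwb d (Nat.pos_of_mem_divisors hd).ne'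
      _ = (N.divisors.card : ℝ) := by simp
      _ ≤ N := by exact_mod_cast Nat.card_divisors_le_self N
  -- `L(c) − 1 = L(c − δ)`
  have hc_sum : LSeriesSummable c s := by rw [hc]; exact h1_sum.convolution hw_sum
  have hδ_sum : LSeriesSummable δ s :=
    LSeriesSummable_of_bounded_of_one_lt_re (m := 1) (fun n _ => by
      simp only [LSeries.delta]; split_ifs <;> simp) hs1
  have hsub : riemannZeta s * plateauMollifier X s - 1 = LSeries (c - δ) s := by
    rw [hprod, LSeries_sub hc_sum hδ_sum]
    congr 1
    have := congrFun LSeries_delta s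
    simpa using this.symm
  rw [hsub]
  -- termwise bound: `‖term (c − δ) s N‖ ≤ [N² > X] N^{-2}`
  set Y := ⌊Real.sqrt X⌋₊ with hY
  have hY1 : 1 ≤ Y := Nat.floor_pos.2 (by rw [Real.le_sqrt (by norm_num) (by linarith)]; linarith)
  have hterm : ∀ N : ℕ, ‖term (c - δ) s N‖ ≤ if Y < N then 1 / ((N : ℝ) ^ 2) else 0 := by
    intro N
    rcases Nat.eq_zero_or_pos N with rfl | hN
    · simp
    rw [term_of_ne_zero hN.ne', norm_div, Complex.norm_natCast_cpow_of_pos hN]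
    have hcδ : (c - δ) N = if N = 1 then 0 else c N := by
      simp only [Pi.sub_apply, LSeries.delta]
      split_ifs with h
      · rw [h, hc1]; ring
      · ring
    rw [hcδ]
    by_cases h1 : N = 1
    · rw [if_pos h1, norm_zero, zero_div]; split_ifs <;> positivity
    rw [if_neg h1]
    have hN2 : 2 ≤ N := by omega
    by_cases hsmall : (N : ℝ) ^ 2 ≤ X
    · rw [hc_small N hN2 hsmall, norm_zero, zero_div]; split_ifs <;> positivity
    · -- `N > Y`
      push Not at hsmall
      have hNY : Y < N := by
        rw [hY]
        refine Nat.floor_lt (Real.sqrt_nonneg _) |>.2 ?_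
        rw [Real.sqrt_lt' (by exact_mod_cast hN)]
        exact hsmall
      rw [if_pos hNY]
      have hNR : (0 : ℝ) < N := by exact_mod_cast hN
      have hpow : (N : ℝ) ^ (3 : ℝ) ≤ (N : ℝ) ^ s.re :=
        Real.rpow_le_rpow_of_exponent_le (by exact_mod_cast hN) hs
      calc ‖c N‖ / (N : ℝ) ^ s.re ≤ N / (N : ℝ) ^ (3 : ℝ) := by
            refine div_le_div₀ (Nat.cast_nonneg N) (hc_bound N hN.ne') (by positivity) hpow
        _ = 1 / (N : ℝ) ^ 2 := by
            rw [show (3 : ℝ) = ((3 : ℕ) : ℝ) by norm_num, Real.rpow_natCast]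
            field_simp
  -- sum the bounds
  have hsumm : Summable fun N => ‖term (c - δ) s N‖ := (hc_sum.sub hδ_sum).norm
  have hle : ‖LSeries (c - δ) s‖ ≤ ∑' N, ‖term (c - δ) s N‖ := norm_tsum_le_tsum_norm hsumm
  refine hle.trans ?_
  have htsum : ∑' N, ‖term (c - δ) s N‖ ≤ 1 / Y := by
    refine Real.tsum_le_of_sum_le (fun N => norm_nonneg _) fun F => ?_
    -- partial sums over any finset
    set K := F.sup id with hK
    calc ∑ N ∈ F, ‖term (c - δ) s N‖ ≤ ∑ N ∈ F, (if Y < N then 1 / ((N : ℝ) ^ 2) else 0) :=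
          Finset.sum_le_sum fun N _ => hterm N
      _ ≤ ∑ N ∈ Finset.Ioc Y K, 1 / ((N : ℝ) ^ 2) := by
          rw [← Finset.sum_filter]
          refine Finset.sum_le_sum_of_subset_of_nonneg ?_ fun _ _ _ => by positivity
          intro N hN
          rw [Finset.mem_filter] at hN
          rw [Finset.mem_Ioc]
          exact ⟨hN.2, Finset.le_sup (f := id) hN.1⟩
      _ ≤ 1 / Y := sum_Ioc_inv_sq_le hY1
  refine htsum.trans ?_
  -- `1/Y ≤ 2 X^{-1/2}` since `Y > √X − 1 ≥ √X/2`
  have hsX : 2 ≤ Real.sqrt X := by rw [Real.le_sqrt (by norm_num) (by linarith)]; linarith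
  have hYgt : Real.sqrt X - 1 < Y := by
    have := Nat.lt_floor_add_one (Real.sqrt X); rw [← hY] at this; linarith
  have hY0 : (0 : ℝ) < Y := by exact_mod_cast hY1
  rw [Real.rpow_neg (by linarith), ← Real.sqrt_eq_rpow, div_le_iff₀ hY0]
  have hsX0 : 0 < Real.sqrt X := by linarith
  rw [show 2 * (Real.sqrt X)⁻¹ * Y = 2 * Y / Real.sqrt X by ring, le_div_iff₀ hsX0]
  linarith

end Literature.NumberTheory.LFunctions.TwistedMoment
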